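import Summits.CriticalPhenomena.SAWScalingLimit.Theses.SAWReversalUpgrade
import Summits.CriticalPhenomena.SAWScalingLimit.Theorems.ForwardDriving.Negative.SAWReversalUpgradeForwardDrivingLoadBearing
import Summits.CriticalPhenomena.SAWScalingLimit.Theorems.ForwardDriving.Negative.SAWReversalUpgradeForwardDrivingOrientation
import Literature.Probability.RandomPlanarGeometry.LocalMartingaleProofs
import Literature.Probability.RandomPlanarGeometry.SAWScalingLimitFamily

/-!
# Disproof of `ForwardDriving` (crux stmt-CriticalPhenomena-18003, route SAWReversalUpgrade) — findings

Standing disprover's work file (cdisprove, cycle 1, 2026-08-17).  VERDICT SO FAR: **no kill**; the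
crux is the honest LSW04 driving-function conjecture for the attached critical `ℤ²` SAW and every
definitional-junk avenue is closed (list in §E).  What IS proved (sorry-free; §0–§C LANDED under
`Theorems/ForwardDriving/Negative/SAWReversalUpgradeForwardDriving{LoadBearing,Orientation}.lean`,
p159408 and p159985 accepted) is the LOAD-BEARING ANALYSIS the provers can cite:

* §0 `not_tendstoLaw_const_sleDriving` — tool: a family of laws under which the observed element of
  `C(Icc 0 1)` is one FIXED path never tends in law to `√κ B|[0,1]` (`κ > 0`): the law of
  `brownian 1` is `gaussianReal 0 1` (no atom), `hasLaw_brownian_sub` + `gaussianReal_absolutelyContinuous`.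
* §A `forwardDriving_false_without_reachable` — drop the `reachable` field of `IsEndpointApprox`
  (keep both mesh-point convergences): FALSE.  Witness: unit disc, `a δ = (⌈δ⁻¹⌉₊+1, 0)`,
  `b δ = (-(⌈δ⁻¹⌉₊+1), 0)` (mesh points `→ ±1` from OUTSIDE the disc): no SAW joins them, `SAW.law = 0`,
  `∫ 1 d0 = 0 ↛ 1`.  (Junk-flavoured: the hypothesis is what makes `SAW.law` a probability law.)
* §B `forwardDriving_false_without_range` — drop the two `Set.range (att δ γ) = …` clauses of the
  standard attachment (keep injective / source / target / interior): FALSE.  Witness: unit disc, the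
  CONSTANT attachment `att δ γ := diameter [1,-1]`; its driving law is a Dirac mass, not Wiener.
  So "any proof must use the prescribed range `S₁`" — the range clause is the whole coupling
  between the SAW and the driving function.
* §B2 `forwardDriving_false_without_orientation` — drop `source = a ∧ target = b` (keep injective,
  interior, range): FALSE.  Witness: the time-reversed standard attachment (`attachmentExists_proof`):
  its class ends at `a`, a described class ends at `b`, so `drivingFunction = 0` (junk), Dirac law.
* §C `not_forwardDrivingRaw` — the NATURAL SIMPLIFICATION "read the driving function of the raw
  polyline class `γ.curve` itself, no attachment" is FALSE BY JUNK: `γ.curve` starts at the interior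
  point `meshPoint δ (a δ) ∈ D`, while a Loewner-described class starts at
  `φ.boundaryExtension (W 0) ∈ ∂D` (`exists_hasBoundaryValue_holds`); hence `γ.curve` is never
  `IsLoewnerDescribable`, `drivingFunction φ γ.curve = 0` (documented junk), Dirac at the zero path.
  Moral for planners: the boundary attachment is not cosmetic; every restatement must keep a curve
  that starts AT `D.pt 0`.
* §D near-misses, sorried with the obstruction in the docstring: `IsChordalUniformizing` dropped
  (needs the standard attachment re-built for a non-chordal `φ`), `Injective` dropped (needs an
  interior-visit invariant of `CurveClass`), `tendsto_fst` / `tendsto_snd` dropped (the GENUINE negatives: the access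
  segment, resp. the exit ray, then hugs `∂D` and `W^δ` is not tight — needs a quantitative Loewner
  estimate for near-real chords).
* §E (docstring `resists_because`) — why no counterexample to the crux itself is in reach: junk
  audit of every `let`, forcing arguments are microscopic in Jordan domains, the `b`-end trimming is
  invisible on `[0,T]` by capacity, the `a`-end trimming is exactly `NoDeepReturn`, boundary hugging
  (the only C-tightness killer) is conformally suppressed; what a kill would need.

Nothing here asserts a Theses decl positively.  Namespace as prescribed.
-/

open scoped NNReal Topology BoundedContinuousFunction unitInterval
open Filter Set MeasureTheory ProbabilityTheory
open Literature.Probability.RandomPlanarGeometry Literature.Probability Literature.Probability.LatticeModels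

namespace Summit.CriticalPhenomena.SAWScalingLimit.Cruxes.ForwardDriving.Disproof

/-! ### §0  Common tool: a deterministic path is not `√κ B` in law (LANDED) -/

/-- LANDED as `…Theorems.ForwardDriving.Negative.not_tendstoLaw_const_sleDriving` (p159408): the law of
`√κ B₁` under the pre-Wiener measure has no atom, so no family of laws under which the observed path is
ONE FIXED point `x₀ ∈ C(Icc 0 1, ℝ)` converges in law to `ω ↦ (√κ B(ω))|[0,1]`, `κ > 0`. [folklore] -/
theorem not_tendstoLaw_const_sleDriving {Ωδ : ℝ → Type*} [∀ δ, MeasurableSpace (Ωδ δ)]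
    (P : ∀ δ, Measure (Ωδ δ)) (x₀ : C(Set.Icc (0:ℝ≥0) 1, ℝ)) {κ : ℝ≥0} (hκ : 0 < κ) :
    ¬ TendstoLaw (fun δ (_ : Ωδ δ) => x₀) P
      (fun ω : ℝ≥0 → ℝ => ((⟨sleDriving κ ω, continuous_sleDriving κ ω⟩ : C(ℝ≥0, ℝ)).restrict
        (Set.Icc (0:ℝ≥0) 1))) Process.preWienerMeasure :=
  Summit.CriticalPhenomena.SAWScalingLimit.Theorems.ForwardDriving.Negative.not_tendstoLaw_const_sleDriving
    P x₀ hκ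

/-! ### §A  Load-bearing: the `reachable` field of `IsEndpointApprox` -/

/-- `ForwardDriving` with the hypothesis `IsEndpointApprox D a b` weakened to its two convergence
fields (`δ·a δ → D.pt 0`, `δ·b δ → D.pt 1`), the eventual joinability of `a δ, b δ` in `Ω_δ`
being DROPPED; everything else verbatim. -/
def ForwardDrivingWithoutReachable : Prop :=
  ∀ (D : Literature.Probability.RandomPlanarGeometry.DobrushinDomain) (a b : ℝ → Literature.Probability.LatticeModels.Site 2), Filter.Tendsto (fun δ => Literature.Probability.LatticeModels.meshPoint δ (a δ)) (nhdsWithin (0:ℝ) (Set.Ioi 0)) (nhds (D.pt 0)) → Filter.Tendsto (fun δ => Literature.Probability.LatticeModels.meshPoint δ (b δ)) (nhdsWithin (0:ℝ) (Set.Ioi 0)) (nhds (D.pt 1)) → ∀ (φ : Literature.Probability.RandomPlanarGeometry.ConformalEquiv UpperHalfPlane.upperHalfPlaneSet D.carrier), D.IsChordalUniformizing φ → ∀ (att : ((δ : ℝ) → Literature.Probability.RandomPlanarGeometry.SAW.DomainSAW (D).carrier δ (a δ) (b δ) → Literature.Probability.RandomPlanarGeometry.Curve ℂ)), (∀ᶠ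 δ in (nhdsWithin (0:ℝ) (Set.Ioi 0)), ∀ γ : Literature.Probability.RandomPlanarGeometry.SAW.DomainSAW (D).carrier δ (a δ) (b δ), (let a₁ := (D).pt 0; let b₁ := (D).pt 1; let P₁ : C(unitInterval, ℂ) := (γ.walk.toCurve (Literature.Probability.LatticeModels.meshPoint δ)); let R₁ := fun u : ℝ => P₁ (Set.projIcc (0:ℝ) 1 zero_le_one u); let φ₁ := (φ).boundaryExtension; let ψ₁ := Function.invFunOn φ₁ {z : ℂ | 0 ≤ z.im}; let e₁ : ℝ := min δ (1/2); let A₁ := fun z : ℂ => (‖z‖ : ℂ) * Complex.exp (Complex.I * ((e₁ : ℂ) + (1 - 2 * (e₁ : ℂ) / (Real.pi : ℂ)) * (Complex.arg z : ℂ))); let Z₁ := fun u : ℝ => @ite ℂ (R₁ u = b₁) (Classical.propDecidable _) b₁ (φ₁ (A₁ (ψ₁ (R₁ u)))); let i₁ := sSup ({(0:ℝ)} ∪ {u | u ∈ Set.Icc (0:ℝ) 1 ∧ R₁ u = a₁}); let j₁ := sInf ({(1:ℝ)} ∪ {u | u ∈ Set.Icc (0:ℝ) 1 ∧ R₁ u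 = b₁}); let M₁ := Z₁ '' Set.Icc i₁ j₁; let p₁ := A₁ (ψ₁ (R₁ i₁)); let q₁ := A₁ (ψ₁ (R₁ j₁)); let s₁ := sInf {s | s ∈ Set.Ioc (0:ℝ) 1 ∧ φ₁ ((s : ℂ) * p₁) ∈ M₁}; let r₁ := sSup ({(1:ℝ)} ∪ {r | 1 ≤ r ∧ R₁ j₁ ≠ b₁ ∧ φ₁ ((r : ℂ) * q₁) ∈ M₁}); let u₁ := sInf {u | u ∈ Set.Icc i₁ j₁ ∧ Z₁ u = φ₁ ((s₁ : ℂ) * p₁)}; let v₁ := sSup ({u | u ∈ Set.Icc i₁ j₁ ∧ R₁ j₁ = b₁ ∧ u = j₁} ∪ {u | u ∈ Set.Icc i₁ j₁ ∧ R₁ j₁ ≠ b₁ ∧ Z₁ u = φ₁ ((r₁ : ℂ) * q₁)}); let S₁ := ((({a₁, b₁} ∪ ((fun s : ℝ => φ₁ ((s : ℂ) * p₁)) '' Set.Ioc 0 s₁)) ∪ (Z₁ '' Set.Icc u₁ v₁)) ∪ ((fun r : ℝ => φ₁ ((r : ℂ) * q₁)) '' {r | r₁ ≤ r ∧ R₁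 j₁ ≠ b₁})); Function.Injective (att δ γ) ∧ (att δ γ).source = a₁ ∧ (att δ γ).target = b₁ ∧ (∀ t : unitInterval, (att δ γ) t = a₁ ∨ (att δ γ) t = b₁ ∨ (att δ γ) t ∈ (D).carrier) ∧ (u₁ < v₁ → Set.range (att δ γ) = S₁) ∧ (¬ u₁ < v₁ → Set.range (att δ γ) = {a₁, b₁} ∪ ((fun y : ℝ => φ₁ (Complex.I * (y : ℂ))) '' Set.Ioi 0)))) → ∀ T : NNReal, Literature.Probability.RandomPlanarGeometry.TendstoLaw (fun δ (γ : Literature.Probability.RandomPlanarGeometry.SAW.DomainSAW D.carrier δ (a δ) (b δ)) => ((⟨Literature.Probability.RandomPlanarGeometry.drivingFunction (φ) (Literature.Probability.RandomPlanarGeometry.CurveClass.mk (att δ γ)), Literature.Probability.RandomPlanarGeometry.continuous_drivingFunction (φ) (Literature.Probability.RandomPlanarGeometry.CurveClass.mk (att δ γ))⟩ : C(NNReal, ℝ)).restrict (Set.Icc (0:NNReal) T))) (fun δ => Literature.Probability.RandomPlanarGeometry.SAW.law (D).carrier δ (a δ) (b δ)) (fun ω : NNReal → ℝ => ((⟨Literature.Probability.RandomPlanarGeometry.sleDriving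 ((8:NNReal)/3) ω, Literature.Probability.RandomPlanarGeometry.continuous_sleDriving ((8:NNReal)/3) ω⟩ : C(NNReal, ℝ)).restrict (Set.Icc (0:NNReal) T))) Literature.Probability.Process.preWienerMeasure

/-- **`reachable` is load-bearing** (`ForwardDrivingWithoutReachable` is false; LANDED p159408 as
`…Negative.forwardDriving_false_without_reachable`).  Witness: the unit
disc with lattice endpoints `a δ = (⌈δ⁻¹⌉₊ + 1, 0)`, `b δ = (-(⌈δ⁻¹⌉₊ + 1), 0)`: their mesh points
`±δ(⌈δ⁻¹⌉₊+1) → ±1 = D.pt 0, D.pt 1` but lie OUTSIDE the open disc for every `δ > 0`, so `a δ` is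
no mesh vertex, no SAW of `Ω_δ` starts there (`DomainSAW` is empty, `a δ ≠ b δ`), `SAW.law = 0`,
the attachment hypothesis is vacuous, and `∫ 1 dlaw = 0` does not tend to `∫ 1 dℙ_W = 1`.
(Junk-flavoured negative: reachability is exactly what makes the SAW law a probability law.) [folklore] -/
theorem forwardDriving_false_without_reachable : ¬ ForwardDrivingWithoutReachable :=
  Summit.CriticalPhenomena.SAWScalingLimit.Theorems.ForwardDriving.Negative.forwardDriving_false_without_reachable

/-! ### §B  Load-bearing: the range prescription of the standard attachment -/

/-- `ForwardDriving` with the standard-attachment hypothesis weakened to its first four conjuncts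
(injective, `source = D.pt 0`, `target = D.pt 1`, interior points in `D`): the two clauses
`u₁ < v₁ → Set.range (att δ γ) = S₁` and `¬ u₁ < v₁ → Set.range (att δ γ) = {a,b} ∪ φ(iℝ₊)` are
DROPPED (and with them the whole `let` block, which only feeds them); everything else verbatim. -/
def ForwardDrivingWithoutRange : Prop :=
  ∀ (D : Literature.Probability.RandomPlanarGeometry.DobrushinDomain) (a b : ℝ → Literature.Probability.LatticeModels.Site 2), Literature.Probability.RandomPlanarGeometry.SAW.IsEndpointApprox D a b → ∀ (φ : Literature.Probability.RandomPlanarGeometry.ConformalEquiv UpperHalfPlane.upperHalfPlaneSet D.carrier), D.IsChordalUniformizing φ → ∀ (att : ((δ : ℝ) → Literature.Probability.RandomPlanarGeometry.SAW.DomainSAW (D).carrier δ (a δ) (b δ) → Literature.Probability.RandomPlanarGeometry.Curve ℂ)), (∀ᶠ δ in (nhdsWithin (0:ℝ) (Set.Ioi 0)), ∀ γ : Literature.Probability.RandomPlanarGeometry.SAW.DomainSAW (D).carrier δ (a δ) (b δ), Function.Injective (att δ γ) ∧ (att δ γ).source = (D).pt 0 ∧ (att δ γ).target = (D).pt 1 ∧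 (∀ t : unitInterval, (att δ γ) t = (D).pt 0 ∨ (att δ γ) t = (D).pt 1 ∨ (att δ γ) t ∈ (D).carrier)) → ∀ T : NNReal, Literature.Probability.RandomPlanarGeometry.TendstoLaw (fun δ (γ : Literature.Probability.RandomPlanarGeometry.SAW.DomainSAW D.carrier δ (a δ) (b δ)) => ((⟨Literature.Probability.RandomPlanarGeometry.drivingFunction (φ) (Literature.Probability.RandomPlanarGeometry.CurveClass.mk (att δ γ)), Literature.Probability.RandomPlanarGeometry.continuous_drivingFunction (φ) (Literature.Probability.RandomPlanarGeometry.CurveClass.mk (att δ γ))⟩ : C(NNReal, ℝ)).restrict (Set.Icc (0:NNReal) T))) (fun δ => Literature.Probability.RandomPlanarGeometry.SAW.law (D).carrier δ (a δ) (b δ)) (fun ω : NNReal → ℝ => ((⟨Literature.Probability.RandomPlanarGeometry.sleDriving ((8:NNReal)/3) ω, Literature.Probability.RandomPlanarGeometry.continuous_sleDriving ((8:NNReal)/3) ω⟩ : C(NNReal, ℝ)).restrict (Set.Icc (0:NNReal) T))) Literature.Probability.Process.preWienerMeasure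

/-- **The range clause is load-bearing** (`ForwardDrivingWithoutRange` is false; LANDED p159408 as
`…Negative.forwardDriving_false_without_range`): without it the
attachment may ignore the walk.  Witness: unit disc `(𝔻; 1, -1)`, any endpoint approximation
(`SAW.exists_isEndpointApprox`), any chordal uniformizer, and the CONSTANT attachment
`att δ γ := (t ↦ 1 - 2t)` (the diameter: injective, from `1` to `-1`, interior in `𝔻`).  Its
driving path through `φ` is one fixed element of `C(Icc 0 1)`, whose Dirac law is not the law of
`√(8/3) B|[0,1]` (`not_tendstoLaw_const_sleDriving`). [folklore] -/
theorem forwardDriving_false_without_range : ¬ ForwardDrivingWithoutRange :=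
  Summit.CriticalPhenomena.SAWScalingLimit.Theorems.ForwardDriving.Negative.forwardDriving_false_without_range

/-! ### §B2  Load-bearing: the orientation clauses of the standard attachment -/

/-- `ForwardDriving` with the two conjuncts `(att δ γ).source = a₁` and `(att δ γ).target = b₁` of the
standard attachment DROPPED (injectivity, interior and both range clauses kept); everything else verbatim. -/
def ForwardDrivingWithoutOrientation : Prop :=
  ∀ (D : Literature.Probability.RandomPlanarGeometry.DobrushinDomain) (a b : ℝ → Literature.Probability.LatticeModels.Site 2), Literature.Probability.RandomPlanarGeometry.SAW.IsEndpointApprox D a b → ∀ (φ : Literature.Probability.RandomPlanarGeometry.ConformalEquiv UpperHalfPlane.upperHalfPlaneSet D.carrier), D.IsChordalUniformizing φ → ∀ (att : ((δ : ℝ) → Literature.Probability.RandomPlanarGeometry.SAW.DomainSAW (D).carrier δ (a δ) (b δ) → Literature.Probability.RandomPlanarGeometry.Curve ℂ)), (∀ᶠ δ in (nhdsWithin (0:ℝ) (Set.Ioi 0)), ∀ γ : Literature.Probability.RandomPlanarGeometry.SAW.DomainSAW (D).carrier δ (a δ) (b δ), (let a₁ := (D).pt 0; let b₁ := (D).pt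 1; let P₁ : C(unitInterval, ℂ) := (γ.walk.toCurve (Literature.Probability.LatticeModels.meshPoint δ)); let R₁ := fun u : ℝ => P₁ (Set.projIcc (0:ℝ) 1 zero_le_one u); let φ₁ := (φ).boundaryExtension; let ψ₁ := Function.invFunOn φ₁ {z : ℂ | 0 ≤ z.im}; let e₁ : ℝ := min δ (1/2); let A₁ := fun z : ℂ => (‖z‖ : ℂ) * Complex.exp (Complex.I * ((e₁ : ℂ) + (1 - 2 * (e₁ : ℂ) / (Real.pi : ℂ)) * (Complex.arg z : ℂ))); let Z₁ := fun u : ℝ => @ite ℂ (R₁ u = b₁) (Classical.propDecidable _) b₁ (φ₁ (A₁ (ψ₁ (R₁ u)))); let i₁ := sSup ({(0:ℝ)} ∪ {u | u ∈ Set.Icc (0:ℝ) 1 ∧ R₁ u = a₁}); let j₁ := sInf ({(1:ℝ)} ∪ {u | u ∈ Set.Icc (0:ℝ) 1 ∧ R₁ u = b₁}); let M₁ := Z₁ '' Set.Icc i₁ j₁; let p₁ := A₁ (ψ₁ (R₁ i₁)); let q₁ := A₁ (ψ₁ (R₁ j₁)); let s₁ := sInf {s | s ∈ Set.Ioc (0:ℝ)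 1 ∧ φ₁ ((s : ℂ) * p₁) ∈ M₁}; let r₁ := sSup ({(1:ℝ)} ∪ {r | 1 ≤ r ∧ R₁ j₁ ≠ b₁ ∧ φ₁ ((r : ℂ) * q₁) ∈ M₁}); let u₁ := sInf {u | u ∈ Set.Icc i₁ j₁ ∧ Z₁ u = φ₁ ((s₁ : ℂ) * p₁)}; let v₁ := sSup ({u | u ∈ Set.Icc i₁ j₁ ∧ R₁ j₁ = b₁ ∧ u = j₁} ∪ {u | u ∈ Set.Icc i₁ j₁ ∧ R₁ j₁ ≠ b₁ ∧ Z₁ u = φ₁ ((r₁ : ℂ) * q₁)}); let S₁ := ((({a₁, b₁} ∪ ((fun s : ℝ => φ₁ ((s : ℂ) * p₁)) '' Set.Ioc 0 s₁)) ∪ (Z₁ '' Set.Icc u₁ v₁)) ∪ ((fun r : ℝ => φ₁ ((r : ℂ) * q₁)) '' {r | r₁ ≤ r ∧ R₁ j₁ ≠ b₁})); Function.Injective (att δ γ) ∧ (∀ t : unitInterval, (att δ γ) t = a₁ ∨ (att δ γ) t = b₁ ∨ (att δ γ) t ∈ (D).carrier) ∧ (u₁ < v₁ → Set.range (att δ γ)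 = S₁) ∧ (¬ u₁ < v₁ → Set.range (att δ γ) = {a₁, b₁} ∪ ((fun y : ℝ => φ₁ (Complex.I * (y : ℂ))) '' Set.Ioi 0)))) → ∀ T : NNReal, Literature.Probability.RandomPlanarGeometry.TendstoLaw (fun δ (γ : Literature.Probability.RandomPlanarGeometry.SAW.DomainSAW D.carrier δ (a δ) (b δ)) => ((⟨Literature.Probability.RandomPlanarGeometry.drivingFunction (φ) (Literature.Probability.RandomPlanarGeometry.CurveClass.mk (att δ γ)), Literature.Probability.RandomPlanarGeometry.continuous_drivingFunction (φ) (Literature.Probability.RandomPlanarGeometry.CurveClass.mk (att δ γ))⟩ : C(NNReal, ℝ)).restrict (Set.Icc (0:NNReal) T))) (fun δ => Literature.Probability.RandomPlanarGeometry.SAW.law (D).carrier δ (a δ) (b δ)) (fun ω : NNReal → ℝ => ((⟨Literature.Probability.RandomPlanarGeometry.sleDriving ((8:NNReal)/3) ω, Literature.Probability.RandomPlanarGeometry.continuous_sleDriving ((8:NNReal)/3) ω⟩ : C(NNReal, ℝ)).restrict (Set.Icc (0:NNReal) T))) Literature.Probability.Process.preWienerMeasure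

/-- **The orientation clauses are load-bearing** (`ForwardDrivingWithoutOrientation` is false; LANDED
p159985 as `…Negative.forwardDriving_false_without_orientation`).  Witness: unit disc, any endpoint
approximation and uniformizer, and the TIME-REVERSED standard attachment `(att δ γ).reverse` (a standard
`att` exists, `attachmentExists_proof`, stmt-18009): same trace, injective, interior, but from `b` to `a`.
A described class ends at `D.pt 1 = b` (`IsCompactifiedImage`), the reversed class ends at `a ≠ b`: not
describable, `drivingFunction = 0`, Dirac law.  Given the range (a simple arc) and injectivity, the
orientation is the only remaining datum of the class; one of the two clauses alone is redundant. [folklore] -/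
theorem forwardDriving_false_without_orientation : ¬ ForwardDrivingWithoutOrientation :=
  Summit.CriticalPhenomena.SAWScalingLimit.Theorems.ForwardDriving.Negative.forwardDriving_false_without_orientation

/-! ### §C  A refuted natural simplification: the raw polyline class has junk driving function -/

/-- The NAIVE form of the crux: read the driving function of the SAW's own curve class `γ.curve`
(the polyline from `δ·a δ` to `δ·b δ`, `DomainSAW.curve`) through `φ`, with no boundary attachment;
hypotheses and target law exactly as in `ForwardDriving`. -/
def ForwardDrivingRaw : Prop :=
  ∀ (D : Literature.Probability.RandomPlanarGeometry.DobrushinDomain) (a b : ℝ → Literature.Probability.LatticeModels.Site 2), Literature.Probability.RandomPlanarGeometry.SAW.IsEndpointApprox D a b → ∀ (φ : Literature.Probability.RandomPlanarGeometry.ConformalEquiv UpperHalfPlane.upperHalfPlaneSet D.carrier), D.IsChordalUniformizing φ → ∀ T : NNReal, Literature.Probability.RandomPlanarGeometry.TendstoLaw (fun δ (γ : Literature.Probability.RandomPlanarGeometry.SAW.DomainSAW D.carrier δ (a δ) (b δ)) => ((⟨Literature.Probability.RandomPlanarGeometry.drivingFunction (φ) ((γ.curve)), Literature.Probability.RandomPlanarGeometry.continuous_drivingFunction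 (φ) ((γ.curve))⟩ : C(NNReal, ℝ)).restrict (Set.Icc (0:NNReal) T))) (fun δ => Literature.Probability.RandomPlanarGeometry.SAW.law (D).carrier δ (a δ) (b δ)) (fun ω : NNReal → ℝ => ((⟨Literature.Probability.RandomPlanarGeometry.sleDriving ((8:NNReal)/3) ω, Literature.Probability.RandomPlanarGeometry.continuous_sleDriving ((8:NNReal)/3) ω⟩ : C(NNReal, ℝ)).restrict (Set.Icc (0:NNReal) T))) Literature.Probability.Process.preWienerMeasure

/-- **The naive form is false, by junk** (`¬ ForwardDrivingRaw`; LANDED p159408 as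
`…Negative.not_forwardDrivingRaw`): for small `δ` the polyline class
`γ.curve` of every SAW starts at the INTERIOR point `meshPoint δ (a δ) ∈ D` (its first vertex lies in
`Ω_δ ⊆ Ω` as soon as `a δ ≠ b δ`), whereas every Loewner-described class through `φ` starts at
`φ.boundaryExtension (W 0)`, a boundary value at the REAL point `W 0`, which lies on `∂D`
(`exists_hasBoundaryValue_holds`) hence not in the open set `D`.  So `γ.curve` is never
`IsLoewnerDescribable φ`, `drivingFunction φ γ.curve = 0` (`drivingFunction_of_not`), and the law of
the zero path is not that of `√(8/3)B|[0,1]`.  Unit disc, any endpoint approximation, any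
uniformizer.  Moral: the attachment `att` (a curve starting AT `D.pt 0`) is not cosmetic. [folklore] -/
theorem not_forwardDrivingRaw : ¬ ForwardDrivingRaw :=
  Summit.CriticalPhenomena.SAWScalingLimit.Theorems.ForwardDriving.Negative.not_forwardDrivingRaw

/-! ### §D  Near-misses (sorried here only; obstruction in each docstring) -/

/-- `ForwardDriving` with the hypothesis `D.IsChordalUniformizing φ` DROPPED (any conformal
equivalence `φ : ℍ → D`); everything else verbatim. -/
def ForwardDrivingWithoutUniformizing : Prop :=
  ∀ (D : Literature.Probability.RandomPlanarGeometry.DobrushinDomain) (a b : ℝ → Literature.Probability.LatticeModels.Site 2), Literature.Probability.RandomPlanarGeometry.SAW.IsEndpointApprox D a b → ∀ (φ : Literature.Probability.RandomPlanarGeometry.ConformalEquiv UpperHalfPlane.upperHalfPlaneSet D.carrier), ∀ (att : ((δ : ℝ) → Literature.Probability.RandomPlanarGeometry.SAW.DomainSAW (D).carrier δ (a δ) (b δ) → Literature.Probability.RandomPlanarGeometry.Curve ℂ)), (∀ᶠ δ in (nhdsWithin (0:ℝ) (Set.Ioi 0)), ∀ γ : Literature.Probability.RandomPlanarGeometry.SAW.DomainSAW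 (D).carrier δ (a δ) (b δ), (let a₁ := (D).pt 0; let b₁ := (D).pt 1; let P₁ : C(unitInterval, ℂ) := (γ.walk.toCurve (Literature.Probability.LatticeModels.meshPoint δ)); let R₁ := fun u : ℝ => P₁ (Set.projIcc (0:ℝ) 1 zero_le_one u); let φ₁ := (φ).boundaryExtension; let ψ₁ := Function.invFunOn φ₁ {z : ℂ | 0 ≤ z.im}; let e₁ : ℝ := min δ (1/2); let A₁ := fun z : ℂ => (‖z‖ : ℂ) * Complex.exp (Complex.I * ((e₁ : ℂ) + (1 - 2 * (e₁ : ℂ) / (Real.pi : ℂ)) * (Complex.arg z : ℂ))); let Z₁ := fun u : ℝ => @ite ℂ (R₁ u = b₁) (Classical.propDecidable _) b₁ (φ₁ (A₁ (ψ₁ (R₁ u)))); let i₁ := sSup ({(0:ℝ)} ∪ {u | u ∈ Set.Icc (0:ℝ) 1 ∧ R₁ u = a₁}); let j₁ := sInf ({(1:ℝ)} ∪ {u | u ∈ Set.Icc (0:ℝ) 1 ∧ R₁ u = b₁}); let M₁ := Z₁ '' Set.Icc i₁ j₁; let p₁ := A₁ (ψ₁ (R₁ i₁)); let q₁ := A₁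 (ψ₁ (R₁ j₁)); let s₁ := sInf {s | s ∈ Set.Ioc (0:ℝ) 1 ∧ φ₁ ((s : ℂ) * p₁) ∈ M₁}; let r₁ := sSup ({(1:ℝ)} ∪ {r | 1 ≤ r ∧ R₁ j₁ ≠ b₁ ∧ φ₁ ((r : ℂ) * q₁) ∈ M₁}); let u₁ := sInf {u | u ∈ Set.Icc i₁ j₁ ∧ Z₁ u = φ₁ ((s₁ : ℂ) * p₁)}; let v₁ := sSup ({u | u ∈ Set.Icc i₁ j₁ ∧ R₁ j₁ = b₁ ∧ u = j₁} ∪ {u | u ∈ Set.Icc i₁ j₁ ∧ R₁ j₁ ≠ b₁ ∧ Z₁ u = φ₁ ((r₁ : ℂ) * q₁)}); let S₁ := ((({a₁, b₁} ∪ ((fun s : ℝ => φ₁ ((s : ℂ) * p₁)) '' Set.Ioc 0 s₁)) ∪ (Z₁ '' Set.Icc u₁ v₁)) ∪ ((fun r : ℝ => φ₁ ((r : ℂ) * q₁)) '' {r | r₁ ≤ r ∧ R₁ j₁ ≠ b₁})); Function.Injective (att δ γ) ∧ (att δ γ).source = a₁ ∧ (att δ γ).target = b₁ ∧ (∀ t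 : unitInterval, (att δ γ) t = a₁ ∨ (att δ γ) t = b₁ ∨ (att δ γ) t ∈ (D).carrier) ∧ (u₁ < v₁ → Set.range (att δ γ) = S₁) ∧ (¬ u₁ < v₁ → Set.range (att δ γ) = {a₁, b₁} ∪ ((fun y : ℝ => φ₁ (Complex.I * (y : ℂ))) '' Set.Ioi 0)))) → ∀ T : NNReal, Literature.Probability.RandomPlanarGeometry.TendstoLaw (fun δ (γ : Literature.Probability.RandomPlanarGeometry.SAW.DomainSAW D.carrier δ (a δ) (b δ)) => ((⟨Literature.Probability.RandomPlanarGeometry.drivingFunction (φ) (Literature.Probability.RandomPlanarGeometry.CurveClass.mk (att δ γ)), Literature.Probability.RandomPlanarGeometry.continuous_drivingFunction (φ) (Literature.Probability.RandomPlanarGeometry.CurveClass.mk (att δ γ))⟩ : C(NNReal, ℝ)).restrict (Set.Icc (0:NNReal) T))) (fun δ => Literature.Probability.RandomPlanarGeometry.SAW.law (D).carrier δ (a δ) (b δ)) (fun ω : NNReal → ℝ => ((⟨Literature.Probability.RandomPlanarGeometry.sleDriving ((8:NNReal)/3) ω, Literature.Probability.RandomPlanarGeometry.continuous_sleDriving ((8:NNReal)/3)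 ω⟩ : C(NNReal, ℝ)).restrict (Set.Icc (0:NNReal) T))) Literature.Probability.Process.preWienerMeasure

/-- NEAR-MISS (not closed).  Plan: take `φ' :=` a chordal uniformizer of `D.swap` (same carrier,
boundary value `b = D.pt 1` at `0` and `a = D.pt 0` at `∞`), which is NOT chordal-uniformizing for
`D`.  Reading the standard attachment through `φ'`: `ψ₁ (δ·a δ)` is huge, `ψ₁ (δ·b δ)` is tiny, the
"access segment" `φ'((0,1]·p₁)` crosses the whole domain from `b`, the "exit ray" ends at `a`;
generically the innermost access crossing is LATE and the outermost exit crossing EARLY, so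
`¬ u₁ < v₁`, the fallback fires and `att δ γ` is the geodesic `{a,b} ∪ φ'(iℝ₊)` run from `a` to `b`;
its pull-back starts at `φ'⁻¹ a = ∞`, i.e. the class is not `IsLoewnerDescribable φ'`
(`a ∉ φ'.boundaryExtension '' closure ℍ`), `drivingFunction = 0`, Dirac law, contradiction as in §C.
OBSTRUCTION: the hypothesis must be met for EVERY walk eventually, so one must decide `u₁ < v₁`
walk by walk for the non-chordal `φ'` and, on the branch `u₁ < v₁`, prove that `S₁` is a simple arc
and parametrise it — the 9-file `AttachmentExists` construction redone for `φ'` (where `S₁` may even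
fail to be an arc, making the variant VACUOUSLY TRUE at `φ'`).  Junk-flavoured either way; recorded
so that nobody re-derives it.  Informal content: `IsChordalUniformizing` is what makes
`drivingFunction φ` see a curve from `0` to `∞`. -/
theorem forwardDriving_false_without_uniformizing : ¬ ForwardDrivingWithoutUniformizing := by
  sorry

/-- `ForwardDriving` with the conjunct `Function.Injective (att δ γ)` of the standard attachment
DROPPED; everything else verbatim. -/
def ForwardDrivingWithoutInjective : Prop :=
  ∀ (D : Literature.Probability.RandomPlanarGeometry.DobrushinDomain) (a b : ℝ → Literature.Probability.LatticeModels.Site 2), Literature.Probability.RandomPlanarGeometry.SAW.IsEndpointApprox D a b → ∀ (φ : Literature.Probability.RandomPlanarGeometry.ConformalEquiv UpperHalfPlane.upperHalfPlaneSet D.carrier), D.IsChordalUniformizing φ → ∀ (att : ((δ : ℝ) → Literature.Probability.RandomPlanarGeometry.SAW.DomainSAW (D).carrier δ (a δ) (b δ) → Literature.Probability.RandomPlanarGeometry.Curve ℂ)), (∀ᶠ δ in (nhdsWithin (0:ℝ) (Set.Ioi 0)), ∀ γ : Literature.Probability.RandomPlanarGeometry.SAW.DomainSAW (D).carrier δ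 (a δ) (b δ), (let a₁ := (D).pt 0; let b₁ := (D).pt 1; let P₁ : C(unitInterval, ℂ) := (γ.walk.toCurve (Literature.Probability.LatticeModels.meshPoint δ)); let R₁ := fun u : ℝ => P₁ (Set.projIcc (0:ℝ) 1 zero_le_one u); let φ₁ := (φ).boundaryExtension; let ψ₁ := Function.invFunOn φ₁ {z : ℂ | 0 ≤ z.im}; let e₁ : ℝ := min δ (1/2); let A₁ := fun z : ℂ => (‖z‖ : ℂ) * Complex.exp (Complex.I * ((e₁ : ℂ) + (1 - 2 * (e₁ : ℂ) / (Real.pi : ℂ)) * (Complex.arg z : ℂ))); let Z₁ := fun u : ℝ => @ite ℂ (R₁ u = b₁) (Classical.propDecidable _) b₁ (φ₁ (A₁ (ψ₁ (R₁ u)))); let i₁ := sSup ({(0:ℝ)} ∪ {u | u ∈ Set.Icc (0:ℝ) 1 ∧ R₁ u = a₁}); let j₁ := sInf ({(1:ℝ)} ∪ {u | u ∈ Set.Icc (0:ℝ) 1 ∧ R₁ u = b₁}); let M₁ := Z₁ '' Set.Icc i₁ j₁; let p₁ := A₁ (ψ₁ (R₁ i₁)); let q₁ := A₁ (ψ₁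 (R₁ j₁)); let s₁ := sInf {s | s ∈ Set.Ioc (0:ℝ) 1 ∧ φ₁ ((s : ℂ) * p₁) ∈ M₁}; let r₁ := sSup ({(1:ℝ)} ∪ {r | 1 ≤ r ∧ R₁ j₁ ≠ b₁ ∧ φ₁ ((r : ℂ) * q₁) ∈ M₁}); let u₁ := sInf {u | u ∈ Set.Icc i₁ j₁ ∧ Z₁ u = φ₁ ((s₁ : ℂ) * p₁)}; let v₁ := sSup ({u | u ∈ Set.Icc i₁ j₁ ∧ R₁ j₁ = b₁ ∧ u = j₁} ∪ {u | u ∈ Set.Icc i₁ j₁ ∧ R₁ j₁ ≠ b₁ ∧ Z₁ u = φ₁ ((r₁ : ℂ) * q₁)}); let S₁ := ((({a₁, b₁} ∪ ((fun s : ℝ => φ₁ ((s : ℂ) * p₁)) '' Set.Ioc 0 s₁)) ∪ (Z₁ '' Set.Icc u₁ v₁)) ∪ ((fun r : ℝ => φ₁ ((r : ℂ) * q₁)) '' {r | r₁ ≤ r ∧ R₁ j₁ ≠ b₁})); (att δ γ).source = a₁ ∧ (att δ γ).target = b₁ ∧ (∀ t : unitInterval, (att δ γ) t = a₁ ∨ (att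 δ γ) t = b₁ ∨ (att δ γ) t ∈ (D).carrier) ∧ (u₁ < v₁ → Set.range (att δ γ) = S₁) ∧ (¬ u₁ < v₁ → Set.range (att δ γ) = {a₁, b₁} ∪ ((fun y : ℝ => φ₁ (Complex.I * (y : ℂ))) '' Set.Ioi 0)))) → ∀ T : NNReal, Literature.Probability.RandomPlanarGeometry.TendstoLaw (fun δ (γ : Literature.Probability.RandomPlanarGeometry.SAW.DomainSAW D.carrier δ (a δ) (b δ)) => ((⟨Literature.Probability.RandomPlanarGeometry.drivingFunction (φ) (Literature.Probability.RandomPlanarGeometry.CurveClass.mk (att δ γ)), Literature.Probability.RandomPlanarGeometry.continuous_drivingFunction (φ) (Literature.Probability.RandomPlanarGeometry.CurveClass.mk (att δ γ))⟩ : C(NNReal, ℝ)).restrict (Set.Icc (0:NNReal) T))) (fun δ => Literature.Probability.RandomPlanarGeometry.SAW.law (D).carrier δ (a δ) (b δ)) (fun ω : NNReal → ℝ => ((⟨Literature.Probability.RandomPlanarGeometry.sleDriving ((8:NNReal)/3) ω, Literature.Probability.RandomPlanarGeometry.continuous_sleDriving ((8:NNReal)/3) ω⟩ : C(NNReal, ℝ)).restrict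 (Set.Icc (0:NNReal) T))) Literature.Probability.Process.preWienerMeasure

/-- NEAR-MISS (not closed).  Plan: from a standard attachment `att` (exists, `AttachmentExists`,
stmt-18009 proved) build `att' δ γ :=` "forward–back–forward" (`t ↦ att(3t)`, `att(2-3t)`,
`att(3t-2)` on thirds): same range, endpoints and interior, not injective, and its class visits
`b = D.pt 1` at an interior time.  No compactified image `s ↦ φ₁ (γ (s/(1-s)))`, `1 ↦ b`, does
(`b ∉ φ₁ '' closure ℍ` for a chordal uniformizer of a Jordan domain), so `CurveClass.mk (att' δ γ)`
is not describable, `drivingFunction = 0`, Dirac law, contradiction as in §C.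
OBSTRUCTION: needs (i) `D.pt 1 ∉ φ.boundaryExtension '' closure upperHalfPlaneSet` (Carathéodory
injectivity including the point at infinity) and (ii) an "interior visit" invariant of the
reparametrisation quotient `CurveClass` (if `mk c = mk c'` and `c` takes the value `p` strictly
between two times where it takes values `q ≠ p ≠ q'`, then `c'` takes the value `p` before time `1`)
— not in the `CurveSpace` API.  Junk-flavoured; informal content: injectivity only pins the CLASS of
the attached curve (two injective parametrisations of the arc `S₁` from `a` to `b` are increasing
reparametrisations of each other). -/
theorem forwardDriving_false_without_injective : ¬ ForwardDrivingWithoutInjective := by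
  sorry

/-- `ForwardDriving` with `IsEndpointApprox D a b` weakened to eventual reachability + the limit
`δ·b δ → D.pt 1` — the limit `δ·a δ → D.pt 0` of the STARTING point DROPPED. -/
def ForwardDrivingWithoutTendstoFst : Prop :=
  ∀ (D : Literature.Probability.RandomPlanarGeometry.DobrushinDomain) (a b : ℝ → Literature.Probability.LatticeModels.Site 2), (∀ᶠ δ in (nhdsWithin (0:ℝ) (Set.Ioi 0)), (Literature.Probability.LatticeModels.discreteDomainGraph D.carrier δ).Reachable (a δ) (b δ)) → Filter.Tendsto (fun δ => Literature.Probability.LatticeModels.meshPoint δ (b δ)) (nhdsWithin (0:ℝ) (Set.Ioi 0)) (nhds (D.pt 1)) → ∀ (φ : Literature.Probability.RandomPlanarGeometry.ConformalEquiv UpperHalfPlane.upperHalfPlaneSet D.carrier), D.IsChordalUniformizing φ → ∀ (att : ((δ : ℝ) → Literature.Probability.RandomPlanarGeometry.SAW.DomainSAW (D).carrier δ (a δ) (b δ) → Literature.Probability.RandomPlanarGeometry.Curve ℂ)), (∀ᶠ δ in (nhdsWithin (0:ℝ) (Set.Ioi 0)), ∀ γ : Literature.Probability.RandomPlanarGeometry.SAW.DomainSAW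 (D).carrier δ (a δ) (b δ), (let a₁ := (D).pt 0; let b₁ := (D).pt 1; let P₁ : C(unitInterval, ℂ) := (γ.walk.toCurve (Literature.Probability.LatticeModels.meshPoint δ)); let R₁ := fun u : ℝ => P₁ (Set.projIcc (0:ℝ) 1 zero_le_one u); let φ₁ := (φ).boundaryExtension; let ψ₁ := Function.invFunOn φ₁ {z : ℂ | 0 ≤ z.im}; let e₁ : ℝ := min δ (1/2); let A₁ := fun z : ℂ => (‖z‖ : ℂ) * Complex.exp (Complex.I * ((e₁ : ℂ) + (1 - 2 * (e₁ : ℂ) / (Real.pi : ℂ)) * (Complex.arg z : ℂ))); let Z₁ := fun u : ℝ => @ite ℂ (R₁ u = b₁) (Classical.propDecidable _) b₁ (φ₁ (A₁ (ψ₁ (R₁ u)))); let i₁ := sSup ({(0:ℝ)} ∪ {u | u ∈ Set.Icc (0:ℝ) 1 ∧ R₁ u = a₁}); let j₁ := sInf ({(1:ℝ)} ∪ {u | u ∈ Set.Icc (0:ℝ) 1 ∧ R₁ u = b₁}); let M₁ := Z₁ '' Set.Icc i₁ j₁; let p₁ := A₁ (ψ₁ (R₁ i₁)); let q₁ := A₁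 (ψ₁ (R₁ j₁)); let s₁ := sInf {s | s ∈ Set.Ioc (0:ℝ) 1 ∧ φ₁ ((s : ℂ) * p₁) ∈ M₁}; let r₁ := sSup ({(1:ℝ)} ∪ {r | 1 ≤ r ∧ R₁ j₁ ≠ b₁ ∧ φ₁ ((r : ℂ) * q₁) ∈ M₁}); let u₁ := sInf {u | u ∈ Set.Icc i₁ j₁ ∧ Z₁ u = φ₁ ((s₁ : ℂ) * p₁)}; let v₁ := sSup ({u | u ∈ Set.Icc i₁ j₁ ∧ R₁ j₁ = b₁ ∧ u = j₁} ∪ {u | u ∈ Set.Icc i₁ j₁ ∧ R₁ j₁ ≠ b₁ ∧ Z₁ u = φ₁ ((r₁ : ℂ) * q₁)}); let S₁ := ((({a₁, b₁} ∪ ((fun s : ℝ => φ₁ ((s : ℂ) * p₁)) '' Set.Ioc 0 s₁)) ∪ (Z₁ '' Set.Icc u₁ v₁)) ∪ ((fun r : ℝ => φ₁ ((r : ℂ) * q₁)) '' {r | r₁ ≤ r ∧ R₁ j₁ ≠ b₁})); Function.Injective (att δ γ) ∧ (att δ γ).source = a₁ ∧ (att δ γ).target = b₁ ∧ (∀ t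 : unitInterval, (att δ γ) t = a₁ ∨ (att δ γ) t = b₁ ∨ (att δ γ) t ∈ (D).carrier) ∧ (u₁ < v₁ → Set.range (att δ γ) = S₁) ∧ (¬ u₁ < v₁ → Set.range (att δ γ) = {a₁, b₁} ∪ ((fun y : ℝ => φ₁ (Complex.I * (y : ℂ))) '' Set.Ioi 0)))) → ∀ T : NNReal, Literature.Probability.RandomPlanarGeometry.TendstoLaw (fun δ (γ : Literature.Probability.RandomPlanarGeometry.SAW.DomainSAW D.carrier δ (a δ) (b δ)) => ((⟨Literature.Probability.RandomPlanarGeometry.drivingFunction (φ) (Literature.Probability.RandomPlanarGeometry.CurveClass.mk (att δ γ)), Literature.Probability.RandomPlanarGeometry.continuous_drivingFunction (φ) (Literature.Probability.RandomPlanarGeometry.CurveClass.mk (att δ γ))⟩ : C(NNReal, ℝ)).restrict (Set.Icc (0:NNReal) T))) (fun δ => Literature.Probability.RandomPlanarGeometry.SAW.law (D).carrier δ (a δ) (b δ)) (fun ω : NNReal → ℝ => ((⟨Literature.Probability.RandomPlanarGeometry.sleDriving ((8:NNReal)/3) ω, Literature.Probability.RandomPlanarGeometry.continuous_sleDriving ((8:NNReal)/3)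 ω⟩ : C(NNReal, ℝ)).restrict (Set.Icc (0:NNReal) T))) Literature.Probability.Process.preWienerMeasure

/-- NEAR-MISS (not closed) — the one GENUINE (non-junk) negative of this list.  If `δ·a δ → a' ∈ ∂D`
with `a' ≠ a = D.pt 0` (take `(a δ, b δ)` an endpoint approximation of the re-marked domain
`(D; a', b)`), the standard attachment still starts at `a`: its access segment is
`φ((0, s₁]·p₁)` with `p₁ = A_e(ψ₁(δ·a δ)) → A_e(x') = |x'| e^{i e₁}` (`x' = φ⁻¹ a' ∈ ℝ ∖ {0}`,
`e₁ = min δ 1/2`), a chord hugging `∂D` from `a` to (near) `a'` at angle `δ`.  Its pull-back has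
half-plane capacity `O(δ x'^2) → 0` while the driving function must travel from `0` to `≈ x'`: the
family `W^δ|[0,T]` is not C-tight (modulus of continuity `≥ |x'|/2` at time-scale `δ`), hence cannot
converge in law to the continuous process `√(8/3)B` — the variant is FALSE for every Jordan domain.
OBSTRUCTION (Lean): needs the quantitative Loewner estimate "a hull containing the segment
`[0, x' e^{iθ}]` has capacity `≤ C θ x'^2` and driving displacement `≥ c x'`" plus tightness ⇒
failure of `TendstoLaw` via a modulus-of-continuity test function and the Brownian modulus tail
(`BrownianOscillationTail`); each piece is standard, the assembly through the `let`-block of the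
attachment is several hundred lines.  Informal content for the provers: `tendsto_fst` is used EXACTLY
to make the access segment short (`|p₁| → 0`), i.e. to make the attachment's surgery at `a` invisible
in capacity. -/
theorem forwardDriving_false_without_tendsto_fst : ¬ ForwardDrivingWithoutTendstoFst := by
  sorry

/-- `ForwardDriving` with `IsEndpointApprox D a b` weakened to eventual reachability + the limit
`δ·a δ → D.pt 0` — the limit `δ·b δ → D.pt 1` of the TERMINAL point DROPPED. -/
def ForwardDrivingWithoutTendstoSnd : Prop :=
  ∀ (D : Literature.Probability.RandomPlanarGeometry.DobrushinDomain) (a b : ℝ → Literature.Probability.LatticeModels.Site 2), (∀ᶠ δ in (nhdsWithin (0:ℝ) (Set.Ioi 0)), (Literature.Probability.LatticeModels.discreteDomainGraph D.carrier δ).Reachable (a δ) (b δ)) → Filter.Tendsto (fun δ => Literature.Probability.LatticeModels.meshPoint δ (a δ)) (nhdsWithin (0:ℝ) (Set.Ioi 0)) (nhds (D.pt 0)) → ∀ (φ : Literature.Probability.RandomPlanarGeometry.ConformalEquiv UpperHalfPlane.upperHalfPlaneSet D.carrier), D.IsChordalUniformizing φ → ∀ (att : ((δ : ℝ) → Literature.Probability.RandomPlanarGeometry.SAW.DomainSAW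 (D).carrier δ (a δ) (b δ) → Literature.Probability.RandomPlanarGeometry.Curve ℂ)), (∀ᶠ δ in (nhdsWithin (0:ℝ) (Set.Ioi 0)), ∀ γ : Literature.Probability.RandomPlanarGeometry.SAW.DomainSAW (D).carrier δ (a δ) (b δ), (let a₁ := (D).pt 0; let b₁ := (D).pt 1; let P₁ : C(unitInterval, ℂ) := (γ.walk.toCurve (Literature.Probability.LatticeModels.meshPoint δ)); let R₁ := fun u : ℝ => P₁ (Set.projIcc (0:ℝ) 1 zero_le_one u); let φ₁ := (φ).boundaryExtension; let ψ₁ := Function.invFunOn φ₁ {z : ℂ | 0 ≤ z.im}; let e₁ : ℝ := min δ (1/2); let A₁ := fun z : ℂ => (‖z‖ : ℂ) * Complex.exp (Complex.I * ((e₁ : ℂ) + (1 - 2 * (e₁ : ℂ) / (Real.pi : ℂ)) * (Complex.arg z : ℂ))); let Z₁ := fun u : ℝ => @ite ℂ (R₁ u = b₁) (Classical.propDecidable _) b₁ (φ₁ (A₁ (ψ₁ (R₁ u)))); let i₁ := sSup ({(0:ℝ)} ∪ {u | u ∈ Set.Icc (0:ℝ) 1 ∧ R₁ u = a₁}); let j₁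 := sInf ({(1:ℝ)} ∪ {u | u ∈ Set.Icc (0:ℝ) 1 ∧ R₁ u = b₁}); let M₁ := Z₁ '' Set.Icc i₁ j₁; let p₁ := A₁ (ψ₁ (R₁ i₁)); let q₁ := A₁ (ψ₁ (R₁ j₁)); let s₁ := sInf {s | s ∈ Set.Ioc (0:ℝ) 1 ∧ φ₁ ((s : ℂ) * p₁) ∈ M₁}; let r₁ := sSup ({(1:ℝ)} ∪ {r | 1 ≤ r ∧ R₁ j₁ ≠ b₁ ∧ φ₁ ((r : ℂ) * q₁) ∈ M₁}); let u₁ := sInf {u | u ∈ Set.Icc i₁ j₁ ∧ Z₁ u = φ₁ ((s₁ : ℂ) * p₁)}; let v₁ := sSup ({u | u ∈ Set.Icc i₁ j₁ ∧ R₁ j₁ = b₁ ∧ u = j₁} ∪ {u | u ∈ Set.Icc i₁ j₁ ∧ R₁ j₁ ≠ b₁ ∧ Z₁ u = φ₁ ((r₁ : ℂ) * q₁)}); let S₁ := ((({a₁, b₁} ∪ ((fun s : ℝ => φ₁ ((s : ℂ) * p₁)) '' Set.Ioc 0 s₁)) ∪ (Z₁ '' Set.Icc u₁ v₁)) ∪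 ((fun r : ℝ => φ₁ ((r : ℂ) * q₁)) '' {r | r₁ ≤ r ∧ R₁ j₁ ≠ b₁})); Function.Injective (att δ γ) ∧ (att δ γ).source = a₁ ∧ (att δ γ).target = b₁ ∧ (∀ t : unitInterval, (att δ γ) t = a₁ ∨ (att δ γ) t = b₁ ∨ (att δ γ) t ∈ (D).carrier) ∧ (u₁ < v₁ → Set.range (att δ γ) = S₁) ∧ (¬ u₁ < v₁ → Set.range (att δ γ) = {a₁, b₁} ∪ ((fun y : ℝ => φ₁ (Complex.I * (y : ℂ))) '' Set.Ioi 0)))) → ∀ T : NNReal, Literature.Probability.RandomPlanarGeometry.TendstoLaw (fun δ (γ : Literature.Probability.RandomPlanarGeometry.SAW.DomainSAW D.carrier δ (a δ) (b δ)) => ((⟨Literature.Probability.RandomPlanarGeometry.drivingFunction (φ) (Literature.Probability.RandomPlanarGeometry.CurveClass.mk (att δ γ)), Literature.Probability.RandomPlanarGeometry.continuous_drivingFunction (φ) (Literature.Probability.RandomPlanarGeometry.CurveClass.mk (att δ γ))⟩ : C(NNReal, ℝ)).restrict (Set.Icc (0:NNReal) T))) (fun δ => Literature.Probability.RandomPlanarGeometry.SAW.law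 (D).carrier δ (a δ) (b δ)) (fun ω : NNReal → ℝ => ((⟨Literature.Probability.RandomPlanarGeometry.sleDriving ((8:NNReal)/3) ω, Literature.Probability.RandomPlanarGeometry.continuous_sleDriving ((8:NNReal)/3) ω⟩ : C(NNReal, ℝ)).restrict (Set.Icc (0:NNReal) T))) Literature.Probability.Process.preWienerMeasure

/-- NEAR-MISS (not closed), genuine like the previous one.  If `δ·b δ → b' ∈ ∂D`, `b' ≠ b = D.pt 1`
(endpoint approximation of the re-marked `(D; a, b')`), the walk never visits `b`, `j₁ = 1`,
`q₁ = A_e(ψ₁(δ·b δ)) → A_e(x')`, `x' = φ⁻¹ b' ∈ ℝ ∖ {0}`, and the attached curve ENDS with the exit ray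
`φ([r₁, ∞)·q₁)`: a chord hugging `∂D` from (near) `b'` to `b` at angle `e₁ = min δ 1/2`.  Its pull-back
reaches modulus `R` at capacity `≍ δ R²` only, so after the (finite, random) capacity `c_γ` of the walk
part the driving function runs off like `√((t - c_γ)/δ)`: on `[0,T]` with `T > c_γ` (positive
probability) `W^δ` is unbounded in probability as `δ → 0`, not tight, no Wiener limit — the variant is
FALSE.  (Before that, the walk part is an SLE₈/₃ aimed at the finite point `x'`, whose driving function
carries the `SLE_κ(κ-6)` drift `∝ 1/(x' - W)` — a second, softer discrepancy.)  OBSTRUCTION (Lean): the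
same quantitative Loewner estimate for near-real chords as in `forwardDriving_false_without_tendsto_fst`,
at the far end instead of the near end.  Informal content: `tendsto_snd` makes the exit ray short IN `ℍ`
(`|q₁| → ∞`), i.e. pushes the attachment's surgery at `b` beyond every finite capacity. -/
theorem forwardDriving_false_without_tendsto_snd : ¬ ForwardDrivingWithoutTendstoSnd := by
  sorry

/-! ### §E  Why the crux itself resists (cycle 1) -/

/-- `resists_because` — the record of the attacks on `ForwardDriving` ITSELF, all unsuccessful, and of
what a kill would need.  (A `True` theorem: the content is this docstring; provers and planners read it.)

**E1. Junk audit of the statement (every avenue closed).**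
* `drivingFunction φ c = if IsLoewnerDescribable φ c then choose else 0`: junk `0` only for
  non-describable classes.  A standard attached curve is an injective curve from `a` to `b` with
  interior in `D`; its pull-back by the Carathéodory homeomorphism is a simple curve in `ℍ ∪ {0}` from
  `0` to `∞`, half-plane capacity continuous, strictly increasing and unbounded (a connected set
  reaching height `h` has `hcap ≳ h²`), so it IS described by its Loewner transform — no junk.
  (Uniqueness of the describing `W` is PROVED, `driving_unique_holds` in `LoewnerDescriptionProofs`, so
  `drivingFunction φ` of a standard attached curve is the honest Loewner transform.)
* `TendstoLaw` is Bochner-integral based: `SAW.DomainSAW` carries `⊤`, and the limit variable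
  `ω ↦ (√κ B ω)|[0,T]` is measurable; `preWienerMeasure` IS Wiener measure (Kolmogorov extension and
  Kolmogorov–Chentsov are PROVED: `isBrownianReal_brownian'`), so neither side integrates to junk `0`.
* `SAW.law = Z⁻¹ • weight`: a probability law eventually (`LawEventuallyProbability`, proved); the
  all-`δ` trap is absent (every clause is `∀ᶠ δ`); `T = 0` is consistent (`W 0 = 0 = sleDriving κ ω 0`).
* The `let` block: `sSup`/`sInf` of empty sets never reached on the main branch (`{0} ∪ …`, `{1} ∪ …`;
  `s₁`'s set contains `1` when `i₁ = 0`, and when the polyline DOES visit `a` one gets `p₁ = 0`,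
  `s₁ = 0`, `u₁ = i₁`, access image `= ∅` — graceful); `ψ₁ b = Classical.choice` is never evaluated
  thanks to the `ite` in `Z₁`; `Complex.arg ∈ [0, π]` on `closure ℍ`; `A_e` is a homeomorphism of
  `closure ℍ` onto the closed sector, `A_e 0 = 0`, commuting with dilations — so `S₁` does not depend
  on the choice of `φ` within its dilation class and `∀ φ` is consistent by Brownian scaling.
* `ConformalEquiv` carries junk values of `toFun` off `ℍ` and of `invFun` off `D`; NOTHING in the
  statement reads them (`boundaryExtension = extendFrom`, `ψ₁ = invFunOn` of it, `drivingFunction`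
  via `IsCompactifiedImage φ.boundaryExtension`).
* Edges of `Ω_δ` are closed segments in `closure Ω` with vertices in `Ω`: the polyline may touch `∂D`
  and even pass through `a` or `b`; the trimming `i₁/j₁`, the `ite`, and the squeeze absorb every
  such configuration (checked by hand on: reflex corner at `a`, one-sided pinch at `a` beyond which
  `a δ` sits, pinch at `b` before `b δ`, `j₁ < i₁` — the last needs a walk through `b` then `a`, which
  a single-file corridor can force only if it dead-ends, and a SAW never enters a visited dead end).

**E2. Geometric forcing is microscopic.**  The only `δ`-dependent data are `a δ, b δ`; a SAW is
forced along a path only in single-file corridors of `Ω_δ`, i.e. where `Ω` is thinner than `2δ`.  In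
a Jordan domain a region of width `→ 0` has diameter `→ 0` (local connectivity of the boundary
curve; a comb with macroscopic teeth is not Jordan), and two lobes cannot be joined by two necks
(simple connectivity), so forced pieces live in `B(a, o(1)) ∪ B(b, o(1))`.  Moreover thin fjords are
conformally TINY (crowding: a fjord of width `w`, length `ℓ` has harmonic size `≍ e^{-πℓ/w}`), so a
forced initial piece has capacity `→ 0` and moves `W` by `→ 0`: invisible on `[0,T]`.

**E3. Trimming at the `b`-end is invisible on `[0,T]`.**  Everything after the OUTERMOST exit-ray
crossing is discarded, but that crossing lies within `o(1)` of `b = φ(∞)`, i.e. beyond half-plane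
capacity `→ ∞`; whatever the walk does afterwards (even a macroscopic excursion — an escape from `b`)
happens at Loewner times `> T` eventually.  So (H7)-type hypotheses are NOT needed for this crux.

**E4. Trimming at the `a`-end is exactly `NoDeepReturn`.**  Everything before the INNERMOST
access-segment crossing is discarded; the access segment has length `|p₁| → 0`, so a macroscopic
change of the attached curve needs an `(ε, r)`-deep return with `r → 0` — probability `→ 0` iff
`NoDeepReturn` (crux #3, stmt-18004) holds at `a`.  A domain violating `NoDeepReturn` would be the
place to look for a counterexample to `ForwardDriving`; none is known, and conformal heuristics
(`P(SLE₈/₃ returns to B(0,η)) ≍ η²`) say none exists among Jordan domains.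

**E5. The only C-tightness killer is boundary hugging, and it is conformally suppressed.**  A piece of
curve running at relative distance `o(1)` from `∂D` over a conformally macroscopic stretch has
capacity `→ 0` while `W` moves macroscopically.  The squeeze `A_{min δ 1/2}` does not create hugging
(it moves points by `O(δ|z|)`); lattice edges INSIDE `∂D` need boundary pieces avoiding all dyadic
lattice points yet meeting every dyadic interval — impossible for a closed set; fixed thin corridors
are conformally unfolded (SAW in a corridor → SLE in the corridor).  No mechanism forces hugging.

**E6. What a kill would need.**  Either (i) a Jordan domain + endpoint approximation with deep returns
to `a` of probability `≥ p > 0` along `δ_k → 0` (kills via E4; would also kill crux #3), proved with a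
SAW estimate in Lean — none exists even on paper; or (ii) a proof that some subsequential driving
limit has `⟨W⟩_t ≠ (8/3)t` — contradicts nothing proved but all numerics (Kennedy 2002/2008:
`κ = 8/3 ± 1%`).  Neither is in reach; the crux is the LSW04 conjecture in driving form.

**E7. Hypotheses possibly unnecessary (information for the prover).**  The interior conjunct
`∀ t, att t = a ∨ att t = b ∨ att t ∈ D` is implied by the range clauses (`S₁ ⊆ D ∪ {a,b}` and
`φ(iℝ₊) ⊆ D`); `Injective` only pins the class (§D); ONE of `source = a` / `target = b` is redundant given
the other + range + injective.  Load-bearing and PROVED so: `reachable` (§A), the range clauses (§B), the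
orientation pair (§B2), reading the ATTACHED curve rather than `γ.curve` (§C); load-bearing, informal:
`tendsto_fst`, `tendsto_snd`, `IsChordalUniformizing` (§D).  Not load-bearing for THIS crux: any
(H7)-type "no escape from b" input (E3). -/
theorem resists_because : True := trivial

end Summit.CriticalPhenomena.SAWScalingLimit.Cruxes.ForwardDriving.Disproof
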